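import Literature.MathematicalPhysics.QuantumFieldTheory.Balaban1983to89.B8IdxB8SubBCollarVacuity
import Literature.MathematicalPhysics.QuantumFieldTheory.Balaban1983to89.B8Prop7HalfSpace
import Literature.MathematicalPhysics.QuantumFieldTheory.Balaban1983to89.B8LeafModelZd3P2

/-!
# `Balaban1983to89.B8Prop7PrintedRZdGF3P2HalfSpace` — THE P₇-CURRENCY NECESSITY CERTIFICATE: [Balaban1985RegularSpaces] Proposition 7 AS TYPED-PRINTED
# (`B8SectGH.Prop7PrintedR`, constant `2α₂` in (1.145)) is FALSE on NODE 00's edition-δ₂ P-carrier `zdGF3HP₂` with print's PINNED tower-wise axial map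
# `toAxialTower`, at a LAWFUL (`IdxB8LawsB`) and ADMISSIBLE (`B8ConstraintBonds.DomainSeq`, print's (1.3)–(1.4)) member — the half-space member `(T, {x_{i₀} ≥ 0})`
# (`d = 4`, `L = 3`, `𝔸 = ℂ`): r05's located erratum G-B8-01 (`B8Prop7HalfSpace.not_prop7PrintedR_halfspace`, witness `U₀ = 1`, `U₁ ≡ e^{iθ}`, crossing bond)
# TRANSPORTED from r05's packaging (`halfspaceGF`, `toAxialHS`) to the objects the «P₂C» pin reads

statement-level skeleton of published theorems with citation tags; proofs where landed; nothing here is a claim about the Yang–Mills mass gap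

T. Bałaban, *Spaces of regular gauge field configurations on a lattice and gauge fixing conditions*, Commun. Math. Phys. **99** (1985) 75–102
`[Balaban1985RegularSpaces]` ("B8"; journal page = PDF page + 74): Prop. 7 (1.143)–(1.145) p. 100, (1.3)–(1.6) p. 77, (1.19) p. 79, (1.29) p. 81, (1.35) p. 82,
p. 77 (bond convention); cell GAPS G-B8-01 (the constant of (1.145) on the bonds crossing `∂Λ_j`).  [3] = `[Balaban1985Averaging]`, (76)–(77), (85)–(87) pp. 29–31.

## WHY THIS FILE (cell `pub-ymgap`, HUMAN RULING D-0062 ∕ D-0149; N05 = [B8]; width seat `pub-ymgap-dag-n05-w2` g2; asked by dag-n05-d g11 WORD-4 (A), bus 04:14Z)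

DESIGN «P₂C» re-pins the N05 slot with Prop. 7 in the REPAIRED currency `B8Ineq145.Prop7RepairedC C₇` instead of the typed-printed `B8SectGH.Prop7PrintedR` (`2α₂`), for print's
tower-wise map `toAxialTower` on the δ₂ carrier over the admissible sub-index `IdxB8SubC = {j : IdxB8SubB θ ∕∕ DomainSeq θ.L j.Ω}`.  Is the weakening NECESSARY?  r05's
`B8Prop7HalfSpace` refuted the printed sentence for ITS OWN packaging (`halfspaceGF 4 3 0 ℂ`, map `U₁ ↦ U₁^{u8}`).  THIS FILE transports the witness to NODE 00's objects:
(§1) the half-space member of NODE 00's index (`k = 1`, `η = L⁻¹`, `Ω = OmegaHS i₀`, towers `Lam i₀`, classes `towerBonds`) is LAWFUL (`IdxB8LawsB`) and ADMISSIBLE (`DomainSeq`);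
(§2) on it print's pinned `uTower` IS r05's `u8` (`glev … 0 0 = (w₀)⁻¹ = 1` on `Λ₀`, [3] (85)); (§3) at `d = 4`, `L = 3`, `𝔸 = ℂ` the typed `Prop7PrintedR` of `zdGF3HP₂` with
`toAxialTower` FAILS there: `α₀ = α₂ = min{c, 1∕16, c(4,3)}`, `U₀ = 1`, `U₁ = e^{iηA}`, `A ≡ 3θ`, `3θ = (27∕28)α₂` meet (1.33) and the carrier's HONEST (1.140) (the canonical
`mlogCfg` IS `A`, `mlogCfg_spec`; flat background), the map is in its unitary regime (`uTower_facts`), and (1.145) ↦ `avgClose (2α₂)` in the ONE-END-POINT class fails at the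
level-1 bond `⟨y, y + e₀⟩`, `y₀ = −1` (`B¹(y + e₀) ⊂ Ω₁`), by r05's `ineq145_fails_lineage` (`2 sin((9∕8)α₂) > 2α₂`).  So the printed `p7` currency CANNOT be served for
print's map on the admissible lawful sub-family; the repaired one is (n05-w1's `B8Prop7TowerAxialRecordP`, this seat's `B8Prop7TowerAxialAdmissible`).

## WHAT IS PROVED (kernel, 0 sorry; theorems only)

* §1 `exists_halfspace_member_lawsB` (any `d`, `L ≥ 1`, `i₀`): the half-space member with ALL fields pinned by equations, `IdxB8LawsB L i` and `DomainSeq L i.Ω`.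
* §2 `uTower_lam_eq_u8` (any C⋆-algebra, `L ≥ 1`): `uTower L hL 1 (Lam i₀) U₀ U₁ = u8 L hL i₀ U₀ U₁`.
* §3 ★★ `not_prop7PrintedR_zdGF3HP₂_toAxialTower_halfspace` (`d = 4`, `L = 3`, `𝔸 = ℂ`, any `β len`): `∃ i : ZdIdx 4 3`, lawful, admissible, `i.Ω 0 = univ`,
  `i.Ω = OmegaHS 0`, with `¬ B8SectGH.Prop7PrintedR (fun _ : Unit => zdGF3HP₂ ℂ 3 β len i) (fun _ => toAxialTower ℂ 3 β len _ i)`; `…_zdGF3P₂…` twin (`Iff.rfl` fields).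

## HONEST SCOPE

A transport of r05's kernel witness (G-B8-01) to NODE 00's carrier ∕ map ∕ index laws; NO estimate of [Balaban1985RegularSpaces] proved anew; `d = 4`, `L = 3`, `𝔸 = ℂ`
as in r05's file (the record's families have odd `L ≥ 5`: the `L`-general re-run of the crossing-bond arithmetic `B8Ineq145Lineage` §5 is LOCATED, not done here —
the mechanism, one block of accumulated axial phase across `∂Λ₁`, is `L`-robust); the certificate is at the CARRIER ∕ MEMBER level (no `Stage3Params` term with
`(D, L, 𝔸) = (4, 3, ℂ)` is constructed, so the record-keyed face `famB8OfRecordSubBP₂C θ` is not instantiated).  It refutes the TYPED-PRINTED currency for print's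
PINNED map at an ADMISSIBLE LAWFUL member; it says nothing against the repaired currency (which holds there: r05's `prop7RepairedC_halfspace`, constant `202dL`).
Count-neutral; N05 NOT discharged; no count claim (the chair's single count line is the only count); `T_η ↦ ℤᵈ`; one finite `𝕋⁴` programme at fixed `ε`, Bałaban AS
PRINTED; the Yang–Mills mass gap (Clay) is NOT proved by any of this — R4 closes the conditional finite-`𝕋⁴` rung `BalabanLadder.UV` only; nothing continuum ∕ ℝ⁴ ∕ OS.
No `sorry`, no `def`, no `instance`, no `notation`.  Unit `pub-ymgap-dag-n05-w2` (g2), 2026-08-28.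

RELATED, NOT DUPLICATED: `B8Prop7HalfSpace` ∕ `B8Ineq145Lineage` (r05: the witness, USED), `B8Prop7TowerAxialZd3` ∕ `…Unitary` (n05-c: the map, USED), `B8LeafModelZd3P2`.

[cite: Balaban1985RegularSpaces, Prop. 7 (1.143)–(1.145) p.100, (1.3)–(1.6) p.77, (1.19) p.79, (1.29) p.81, (1.35) p.82, p.77; Balaban1985Averaging, (76)–(77) pp.29–30, (85)–(87) p.31]
-/

noncomputable section

open NormedSpace

namespace Literature.MathematicalPhysics.QuantumFieldTheory.Balaban1983to89.B8Prop7PrintedRZdGF3P2HalfSpace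

open Complex (I)
open B7Prop1Explicit B7Prop1Local B7Prop2Explicit B7Eq92Concrete B7Eq84Concrete
open B8Ineq130 (tlo thi tlo_apply thi_apply)
open B8Ineq132 (Under InAk covDerivFwd)
open B8Eq140Level (SideTouches)
open B8Eq143PlaqExpansion (pdiv)
open B8Eq146AExpansion (plaqCovDeriv plaqCovDeriv_eq_covDerivFwd)
open B8Eq184Proof (cfgExp)
open B8Lemma1NonAbelian (mulCfg)
open B8Thm4Concrete (mulCfg_eq_mul)
open B8Eq131Cubes (flm under_flm)
open B8CubeMemberZd (inBox_tower_iff_under)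
open B8Eq191FlatLettersCubeMember (under_iff_blockMap_eq)
open B8IdxB8LawsB (towerBonds towerBonds_hbox towerBonds_hclass IdxB8LawsB)
open B8ConstraintBonds (DomainSeq)
open B8LeafModelZd (ZdIdx)
open B8LeafModelZd3 (zdGF3 mlogCfg mlogCfg_spec)
open B8LeafModelZd3P (EndBlockIn)
open B8LeafModelZd3P2 (zdGF3P₂ zdGF3HP₂)
open B8Prop7AdmittedFamily (cst cst_pos)
open B8Prop7TowerAxialZd3 (Covered InTower towerDepth uTower toAxialTower toAxialTower_of_unitary uTower_of_covered covered_of_under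
  towerDepth_eq_of_maximal)
open B8Prop7TowerAxialUnitary (uTower_facts)
open B8Ineq145Lineage (eI u8 hyp139 hyp140_grad ineq145_fails_lineage Lam mem_Lam_zero mem_Lam_one)
open B8Prop7HalfSpace (OmegaHS omegaHS_zero omegaHS_one sideTouches_omegaHS_zero)
open B9SupplySockB9P3ZdSocketBoundaryMode (cfgExp_mem_unitaryUnits)
open Node00 (IdxB8Laws)
open Literature.MathematicalPhysics.QuantumLattice (blockMap blockSites mem_blockSites_iff)

-- `Site` alone could resolve to the torus sites of `Setup.lean`; re-export the `ℤ^d` sites of `B7Prop1Explicit`.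
export B7Prop1Explicit (Site)

variable {d : ℕ}

/-! ## §1 The half-space member of NODE 00's index: lawful and admissible -/

section Member

variable {L : ℕ}

/-- `Ω_{j+2} = ∅` for the half-space family. [cite: Balaban1985RegularSpaces, (1.3) p.77 (bookkeeping)] -/
theorem omegaHS_add_two (i₀ : Fin d) (j : ℕ) : OmegaHS i₀ (j + 2) = ∅ := rfl

/-- ★ **THE HALF-SPACE MEMBER `(T, {x_{i₀} ≥ 0})` OF NODE 00's INDEX IS LAWFUL AND ADMISSIBLE** (every `d`, `L ≥ 1`, `i₀`): depth `k = 1`, spacing `η = L⁻¹`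
(law №7 with equality), regions `Ω = OmegaHS i₀`, towers `Λs 1 = Lam i₀` (`Λ₁ = {z : 0 ≤ z_{i₀}}` as `1`-blocks, `Λ₀ = {x : x_{i₀} < 0}` as sites) and `Λs 0 0 = ℤᵈ`
(№8 at the top), bond classes `towerBonds` (№12); the `ZdIdx` laws, `IdxB8LawsB` (№7 ∕ №8 ∕ №11 ∕ №12) and `B8ConstraintBonds.DomainSeq` ((1.3) nesting, (1.4)
saturation — `Ω₁` is a union of `L`-blocks — and separation — vacuous above `Ω₁`, `Ω₀ = ℤᵈ`) all hold.
[cite: Balaban1985RegularSpaces, (1.3)–(1.6) p.77, (1.19) p.79, p.86 («𝔅_k»)] -/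
theorem exists_halfspace_member_lawsB (hL : 1 ≤ L) (i₀ : Fin d) :
    ∃ i : ZdIdx d L, i.k = 1 ∧ i.η = ((L : ℝ)⁻¹) ∧ i.Ω = OmegaHS i₀ ∧ i.Λs 1 = Lam i₀ ∧
      (∀ m j, i.Λb m j = towerBonds L i.Ω (i.Λs m) j) ∧ IdxB8LawsB L i ∧ DomainSeq L i.Ω := by
  classical
  haveI : NeZero L := ⟨by omega⟩
  have hL0 : (0 : ℤ) < (L : ℤ) := by exact_mod_cast hL
  let ΛT : ℕ → ℕ → Set (Site d) := fun m j => if m = 0 then (if j = 0 then Set.univ else ∅) else Lam i₀ j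
  have hT1 : ∀ j, ΛT 1 j = Lam i₀ j := fun j => by simp [ΛT]
  have hT00 : ΛT 0 0 = Set.univ := by simp [ΛT]
  have hanti : ∀ j, OmegaHS i₀ (j + 1) ⊆ OmegaHS i₀ j := by
    intro j
    rcases j with _ | _ | j
    · rw [omegaHS_zero]; exact Set.subset_univ _
    · show OmegaHS i₀ (0 + 2) ⊆ _; rw [omegaHS_add_two]; exact Set.empty_subset _
    · show OmegaHS i₀ ((j + 1) + 2) ⊆ _; rw [omegaHS_add_two]; exact Set.empty_subset _
  -- the floor block of a site of `Ω₁` is a top of `Λ₁`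
  have hflm : ∀ x : Site d, 0 ≤ x i₀ → flm L 1 x ∈ Lam i₀ 1 := fun x hx => by
    rw [mem_Lam_one]
    show 0 ≤ x i₀ / (L : ℤ) ^ 1
    rw [pow_one]; exact Int.ediv_nonneg hx hL0.le
  have hself0 : ∀ x : Site d, InBox (tlo L x 0) (thi L x 0) x := fun x i => by
    simp [B8Ineq130.tlo_zero, B8Ineq130.thi_zero]
  refine ⟨⟨((L : ℝ)⁻¹), by positivity, 1, le_rfl, OmegaHS i₀, hanti, ΛT, fun m j => towerBonds L (OmegaHS i₀) (ΛT m) j,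
    towerBonds_hbox L _ ΛT 1, towerBonds_hclass L _ ΛT 1, ?_, ?_⟩, rfl, rfl, rfl, funext (hT1 ·), fun _ _ => rfl, ?_, ?_⟩
  · -- htower
    intro j hj y hy x hx
    rcases Nat.eq_zero_or_pos j with rfl | hjpos
    · rw [omegaHS_zero]; exact Set.mem_univ x
    · have hj1 : j = 1 := by omega
      subst hj1
      rw [hT1, mem_Lam_one] at hy
      rw [omegaHS_one]
      have h1 := (hx i₀).1
      rw [tlo_apply, pow_one] at h1
      show 0 ≤ x i₀
      nlinarith
  · -- hpart
    intro x _
    by_cases hx : 0 ≤ x i₀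
    · exact ⟨1, le_rfl, flm L 1 x, by rw [hT1]; exact hflm x hx, (inBox_tower_iff_under L 1 _ x).2 (under_flm hL 1 x)⟩
    · exact ⟨0, Nat.zero_le 1, x, by rw [hT1, mem_Lam_zero]; exact lt_of_not_ge hx, hself0 x⟩
  · -- the located laws
    refine ⟨⟨?_, ?_, ?_, ?_⟩, fun _ _ => rfl⟩
    · -- №7
      show (L : ℝ) ^ 1 * (L : ℝ)⁻¹ ≤ 1
      rw [pow_one, mul_inv_cancel₀ (by exact_mod_cast (show L ≠ 0 by omega))]
    · -- №8 below the top: vacuous at `k = 1`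
      intro m hm j hj
      change m < 1 at hm
      exact absurd hj (by omega)
    · -- №8 at the top (`m = 0`)
      intro m hm x
      change m < 1 at hm
      have hm0 : m = 0 := by omega
      subst hm0
      show x ∈ ΛT 0 0 ↔ x ∈ ΛT 1 0 ∨ ∃ y ∈ ΛT 1 1, x ∈ blockSites L y
      rw [hT00, hT1, hT1, mem_Lam_zero]
      refine ⟨fun _ => ?_, fun _ => Set.mem_univ x⟩
      by_cases hx : 0 ≤ x i₀
      · refine Or.inr ⟨flm L 1 x, hflm x hx, ?_⟩
        rw [mem_blockSites_iff]
        have := (under_iff_blockMap_eq hL 1 (flm L 1 x) x).1 (under_flm hL 1 x)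
        rwa [pow_one] at this
      · exact Or.inl (lt_of_not_ge hx)
    · -- №11 (1.6)
      intro ℓ hℓ w hw
      change ℓ ≤ 1 at hℓ
      show ∃ j, ℓ ≤ j ∧ j ≤ 1 ∧ ∃ y ∈ ΛT 1 j, Under L (j - ℓ) y w
      rcases Nat.eq_zero_or_pos ℓ with rfl | hℓpos
      · by_cases hw0 : 0 ≤ w i₀
        · exact ⟨1, Nat.zero_le 1, le_rfl, flm L 1 w, by rw [hT1]; exact hflm w hw0, under_flm hL 1 w⟩
        · refine ⟨0, le_rfl, Nat.zero_le 1, w, by rw [hT1, mem_Lam_zero]; exact lt_of_not_ge hw0, ?_⟩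
          exact (B8Eq131Derivation.under_zero_iff L w w).2 rfl
      · have hℓ1 : ℓ = 1 := by omega
        subst hℓ1
        have hw0 : 0 ≤ w i₀ := by
          have h := hw (tlo L w 1) (fun i => by rw [tlo_apply, thi_apply]; constructor <;> nlinarith)
          change tlo L w 1 ∈ OmegaHS i₀ 1 at h
          rw [omegaHS_one] at h
          have h' : 0 ≤ (tlo L w 1) i₀ := h
          rw [tlo_apply, pow_one] at h'
          nlinarith
        exact ⟨1, le_rfl, le_rfl, w, by rw [hT1, mem_Lam_one]; exact hw0, (B8Eq131Derivation.under_zero_iff L w w).2 rfl⟩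
  · -- `DomainSeq`
    refine ⟨hanti, ?_, ?_⟩
    · intro n x y hxy hx
      rcases n with _ | _ | n
      · exact Set.mem_univ y
      · change x ∈ OmegaHS i₀ 1 at hx
        change y ∈ OmegaHS i₀ 1
        rw [omegaHS_one] at hx ⊢
        have hx' : 0 ≤ x i₀ := hx
        have hq := congrFun hxy i₀
        norm_num [blockMap] at hq
        show 0 ≤ y i₀
        by_contra hy
        have hy' : y i₀ < 0 := lt_of_not_ge hy
        have h1 : 0 ≤ x i₀ / (L : ℤ) := Int.ediv_nonneg hx' hL0.le
        have h2 : y i₀ / (L : ℤ) < 0 := Int.ediv_lt_of_lt_mul hL0 (by rw [zero_mul]; exact hy')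
        rw [hq] at h1
        exact absurd h1 (not_le.mpr h2)
      · exact absurd hx (by show x ∉ OmegaHS i₀ (n + 2); rw [omegaHS_add_two]; exact Set.notMem_empty x)
    · intro n x t hx _
      rcases n with _ | n
      · exact Set.mem_univ _
      · exact absurd hx (by show x ∉ OmegaHS i₀ (n + 2); rw [omegaHS_add_two]; exact Set.notMem_empty x)

end Member

/-! ## §2 Print's pinned gauge transformation on the half-space member IS r05's `u8` -/

section Gauge

variable {𝔸 : Type*} [NormedRing 𝔸] [NormedAlgebra ℂ 𝔸] [CompleteSpace 𝔸] {L : ℕ}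

/-- ★ **`uTower = u8` ON THE HALF-SPACE TOWERS** (`L ≥ 1`): every site is covered; under `Λ₁` the deepest listed tower is the `1`-block (depth `1`, [3]'s `glev … 1 0`);
on `Λ₀` it is the site itself (depth `0`, `glev … 0 0 = (w₀)⁻¹ = 1` by [3] (85) `w₀ := 1`) — which is r05's `u8` verbatim.
[cite: Balaban1985RegularSpaces, (1.29) p.81, (1.14) p.78; Balaban1985Averaging, (76)–(77) pp.29–30, (85)–(87) p.31] -/
theorem uTower_lam_eq_u8 (hL : 1 ≤ L) (i₀ : Fin d) (U₀ U₁ : Site d → Fin d → 𝔸ˣ) :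
    uTower L hL 1 (Lam i₀) U₀ U₁ = u8 L hL i₀ U₀ U₁ := by
  have hL0 : (0 : ℤ) < (L : ℤ) := by exact_mod_cast hL
  funext x
  by_cases hx : 0 ≤ x i₀
  · -- under `Λ₁`: depth `1`
    have hy : flm L 1 x ∈ Lam i₀ 1 := by
      rw [mem_Lam_one]; show 0 ≤ x i₀ / (L : ℤ) ^ 1; rw [pow_one]; exact Int.ediv_nonneg hx hL0.le
    have hux := under_flm hL 1 x
    have hcov : Covered L 1 (Lam i₀) x := covered_of_under le_rfl hy hux
    have hdep : towerDepth L 1 (Lam i₀) x = 1 :=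
      towerDepth_eq_of_maximal le_rfl hy hux (fun J hJ hJ1 => absurd hJ1 (by omega))
    rw [uTower_of_covered hcov, hdep]
    simp [u8, hx]
  · -- on `Λ₀`: depth `0`
    have hx' : x i₀ < 0 := lt_of_not_ge hx
    have hy : x ∈ Lam i₀ 0 := by rw [mem_Lam_zero]; exact hx'
    have hux : Under L 0 x x := (B8Eq131Derivation.under_zero_iff L x x).2 rfl
    have hcov : Covered L 1 (Lam i₀) x := covered_of_under (Nat.zero_le 1) hy hux
    have hdep : towerDepth L 1 (Lam i₀) x = 0 := by
      refine towerDepth_eq_of_maximal (Nat.zero_le 1) hy hux (fun J hJ hJ1 => ?_)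
      have hJ' : J = 1 := by omega
      subst hJ'
      rintro ⟨y, hy1, hyx⟩
      rw [mem_Lam_one] at hy1
      have h1 := (hyx i₀).1
      rw [pow_one] at h1
      nlinarith
    rw [uTower_of_covered hcov, hdep, glev_top, B7Eq99Concrete.wrec_zero, inv_one]
    simp [u8, hx]

end Gauge

/-! ## §3 The typed-printed Proposition 7 FAILS on the δ₂ carrier with the pinned map at the half-space member (`d = 4`, `L = 3`, `𝔸 = ℂ`) -/

section Printed

/-- `1 ≤ 3`. [folklore] -/
private theorem one_le_three : (1 : ℕ) ≤ 3 := by norm_num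

/-- The witness exponent: `e^{iη·A} = e^{iθ}` bondwise for `η = 1∕3`, `A ≡ 3θ` (private arithmetic). [folklore] -/
private theorem cfgExp_third_eq (θ : ℝ) :
    cfgExp ((3 : ℝ)⁻¹) (fun (_ : Site 4) (_ : Fin 4) => (((3 * θ : ℝ)) : ℂ)) = B8Ineq145Lineage.cst (eI θ) := by
  funext x κ
  show expUnit (I • (((3 : ℝ)⁻¹) • (((3 * θ : ℝ)) : ℂ))) = expUnit (I * (θ : ℂ))
  congr 1
  rw [smul_eq_mul, Complex.real_smul]
  push_cast
  ring

/-- ★★ **THE TYPED-PRINTED PROPOSITION 7 (`B8SectGH.Prop7PrintedR`, constant `2α₂`) IS FALSE ON NODE 00's δ₂ CARRIER `zdGF3HP₂` WITH PRINT'S PINNED TOWER-WISE MAP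
`toAxialTower`, AT THE LAWFUL ADMISSIBLE HALF-SPACE MEMBER** (`d = 4`, `L = 3`, `𝔸 = ℂ`, any `β`, `len`): for every threshold `c > 0` the data `α₀ = α₂ =
min{c, 1∕16, c(4,3)}`, `U₀ = 1`, `U₁ = e^{iηA}`, `A ≡ 3θ`, `3θ = (27∕28)α₂` satisfy (1.33) `InA` and the carrier's honest (1.140) `C140` (the canonical `mlogCfg` is `A`:
`mlogCfg_spec`; flat background), the map is in its unitary regime (`uTower_facts`, so `U′ = U₁^{uTower}` with `uTower = u8`, §2), and the conclusion (1.145) ↦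
`avgClose (2α₂)` in the ONE-END-POINT class fails at the level-`1` bond `⟨y, y + e₀⟩`, `y₀ = −1` (`B¹(y + e₀) ⊂ Ω₁`): r05's `ineq145_fails_lineage` gives `2α₂ <` the
left member.  The member is lawful and `DomainSeq`-admissible (§1) — an `IdxB8SubC`-type member at `(D, L, 𝔸) = (4, 3, ℂ)` — so the «P₂C» weakening of `p7` to
`Prop7RepairedC C₇` is NECESSARY for print's map, not a convenience.
[cite: Balaban1985RegularSpaces, Prop. 7 (1.143)–(1.145) p.100, (1.35) p.82, p.77, (1.3)–(1.4) p.77; Balaban1985Averaging, (76)–(77) pp.29–30, (87) p.31] -/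
theorem not_prop7PrintedR_zdGF3HP₂_toAxialTower_halfspace (β : ℝ) (len : Site 4 → ℝ) :
    ∃ i : ZdIdx 4 3, IdxB8LawsB 3 i ∧ DomainSeq 3 i.Ω ∧ i.Ω 0 = Set.univ ∧ i.Ω = OmegaHS (0 : Fin 4) ∧
      ¬ B8SectGH.Prop7PrintedR (fun _ : Unit => zdGF3HP₂ ℂ 3 β len i) (fun _ => toAxialTower ℂ 3 β len one_le_three i) := by
  obtain ⟨i, hik, hiη, hΩ, hΛ, -, hlaws, hadm⟩ := exists_halfspace_member_lawsB (d := 4) one_le_three (0 : Fin 4)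
  have hΩ0 : i.Ω 0 = Set.univ := by rw [hΩ]; exact omegaHS_zero 0
  refine ⟨i, hlaws, hadm, hΩ0, hΩ, ?_⟩
  rintro ⟨c, hc, H⟩
  -- the smallness parameters
  set α₂ : ℝ := min c (min (1 / 16) (cst 4 3)) with hα₂
  have hcst : 0 < cst 4 3 := cst_pos (by norm_num) 3 (by norm_num)
  have h0 : 0 < α₂ := lt_min hc (lt_min (by norm_num) hcst)
  have hc2 : α₂ ≤ c := min_le_left _ _
  have h16 : α₂ ≤ 1 / 16 := (min_le_right _ _).trans (min_le_left _ _)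
  have hcs : α₂ ≤ cst 4 3 := (min_le_right _ _).trans (min_le_right _ _)
  have h4 : α₂ ≤ 1 / 4 := h16.trans (by norm_num)
  set θ : ℝ := 9 / 28 * α₂ with hθdef
  have hθ : (3 : ℝ) * θ = 27 / 28 * α₂ := by rw [hθdef]; ring
  have hθpos : 0 < θ := by positivity
  have h3θ : 0 < 3 * θ := by positivity
  -- the data on the member: `η = 1∕3`, `U₀ = 1`, `U₁ = e^{iηA}`, `A ≡ 3θ`
  have hη : i.η = (3 : ℝ)⁻¹ := by rw [hiη]; norm_num
  let A : Site 4 → Fin 4 → ℂ := fun _ _ => (((3 * θ : ℝ)) : ℂ)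
  have hAh : ∀ (y : Site 4) (κ : Fin 4), IsSelfAdjoint (A y κ) := fun _ _ => by
    show star (((3 * θ : ℝ)) : ℂ) = ((3 * θ : ℝ) : ℂ)
    rw [Complex.star_def, Complex.conj_ofReal]
  have hnormA : ∀ (y : Site 4) (κ : Fin 4), ‖A y κ‖ = 3 * θ := fun _ _ => by
    show ‖(((3 * θ : ℝ)) : ℂ)‖ = 3 * θ
    rw [Complex.norm_real, Real.norm_eq_abs, abs_of_pos h3θ]
  let U₀ : (zdGF3HP₂ ℂ 3 β len i).Cfg := ⟨1, fun _ _ => (unitaryUnits ℂ).one_mem⟩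
  let U₁ : {U : Site 4 → Fin 4 → ℂˣ // ∀ x κ, U x κ ∈ unitaryUnits ℂ} :=
    ⟨cfgExp i.η A, fun x κ => cfgExp_mem_unitaryUnits i.η hAh x κ⟩
  let P : (zdGF3HP₂ ℂ 3 β len i).Pert := (U₀, U₁)
  have hU₁ : (P.2.1 : Site 4 → Fin 4 → ℂˣ) = B8Ineq145Lineage.cst (eI θ) := by
    show cfgExp i.η A = _; rw [hη]; exact cfgExp_third_eq θ
  -- (1.33) for `U₀ = 1`
  have hInA : (zdGF3 ℂ 3 β len i).InA α₂ U₀ := by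
    show InAk 3 i.k i.η α₂ i.Ω (1 : Site 4 → Fin 4 → ℂˣ)
    exact hyp139 3 one_le_three i.k i.hη h0 i.Ω
  -- (1.140) in the carrier's honest body: the canonical masked logarithm is `A`
  have hall : ∀ (y : Site 4) (τ : Fin 4), SideTouches (i.Ω 0) y τ := fun y τ => by
    rw [hΩ]; exact sideTouches_omegaHS_zero (by norm_num) 0 y τ
  have hWA : ∀ j, j ≤ i.k → ∀ (y : Site 4) (τ : Fin 4), SideTouches (i.Ω j) y τ →
      P.2.1 y τ = cfgExp i.η A y τ ∧ ‖A y τ‖ ≤ α₂ * ((3 : ℝ) ^ j * i.η)⁻¹ := by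
    intro j hj y τ _
    refine ⟨rfl, ?_⟩
    rw [hik] at hj
    rw [hnormA y τ, hη]
    interval_cases j
    · norm_num; linarith
    · norm_num; linarith
  obtain ⟨hmsa, hmeq, -⟩ := mlogCfg_spec (W := P.2.1) i.hη one_le_three i.k (1 : Site 4 → Fin 4 → ℂˣ) P.2.2 h0.le
    (by linarith) i.Ω hWA
  have hmA : mlogCfg i.k i.η i.Ω P.2.1 = A := by
    funext y τ
    exact (hmeq 0 (Nat.zero_le _) y τ (hall y τ)).1
  have hgrad1 : ∀ (κ τ : Fin 4) (y : Site 4), covDerivFwd i.η (1 : Site 4 → Fin 4 → ℂˣ) κ (fun z => A z τ) y = 0 :=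
    fun κ τ y => hyp140_grad i.η _ κ y
  have hplaq1 : plaqCovDeriv i.η (1 : Site 4 → Fin 4 → ℂˣ) A = fun _ _ _ => 0 := by
    funext μ ν x
    rw [plaqCovDeriv_eq_covDerivFwd, hgrad1 μ ν x, hgrad1 ν μ x, sub_zero]
  have hdiv1 : ∀ (μ : Fin 4) (y : Site 4), pdiv i.η (1 : Site 4 → Fin 4 → ℂˣ) (plaqCovDeriv i.η 1 A) μ y = 0 := by
    intro μ y
    rw [hplaq1]
    simp [pdiv, B8Ineq132.covDeriv, B7Eq78Linearization.conjR_apply]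
  have hgrad : ∀ (κ τ : Fin 4) (y : Site 4), covDerivFwd i.η U₀.1 κ (fun z => A z τ) y = 0 := hgrad1
  have hdiv : ∀ (μ : Fin 4) (y : Site 4), pdiv i.η U₀.1 (plaqCovDeriv i.η U₀.1 A) μ y = 0 := hdiv1
  have h140 : (zdGF3 ℂ 3 β len i).C140 α₂ U₀ P := by
    intro j hj y τ hst
    rw [hmA]
    rw [hik] at hj
    refine ⟨rfl, hAh y τ, ?_, fun κ => ?_, ?_⟩
    · rw [hnormA y τ, hη]
      interval_cases j
      · norm_num; linarith
      · norm_num; linarith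
    · rw [hgrad κ τ y, norm_zero, mul_zero]; exact h0
    · rw [hdiv τ y, norm_zero, mul_zero]; exact h0
  -- the map is in its unitary regime: `U′ = U₁^{uTower}`, `uTower = u8`
  have hunit := fun x => (uTower_facts (𝔸 := ℂ) (β := β) (len := len) (by norm_num : 2 ≤ 4) (by norm_num : 2 ≤ 3) i hΩ0
    h0 hcs h0 hcs U₀ P hInA h140 x).1
  have hTA := toAxialTower_of_unitary (𝔸 := ℂ) (β := β) (len := len) one_le_three i U₀ P hunit
  -- the conclusion (1.145) at the crossing bond
  obtain ⟨-, havg⟩ := H () α₂ α₂ h0 hc2 h0 hc2 U₀ P hInA h140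
  let y : Site 4 := fun j => if j = 0 then -1 else 0
  have hy : y 0 = -1 := by simp [y]
  have hend : EndBlockIn 3 (i.Ω 1) 1 y 0 := by
    refine Or.inr fun x hx => ?_
    rw [hΩ, omegaHS_one]
    show 0 ≤ x 0
    have h1 := (hx 0).1
    rw [tlo_apply, pow_one] at h1
    simp only [Pi.add_apply, e_apply, if_true, y] at h1
    linarith
  have hle := havg 1 (by rw [hik]) y 0 hend
  dsimp only at hle
  rw [hTA] at hle
  -- rewrite the member's data into r05's letters
  have hLHS : (avgIter 3 (mulCfg (mgauge U₀.1 (uTower 3 one_le_three i.k (i.Λs i.k) U₀.1 P.2.1) P.2.1) U₀.1) 1 y 0 : ℂ)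
      = (avgIter 3 (mgauge 1 (u8 3 one_le_three (0 : Fin 4) 1 (B8Ineq145Lineage.cst (eI θ))) (B8Ineq145Lineage.cst (eI θ))
          * (1 : Site 4 → Fin 4 → ℂˣ)) 1 y 0 : ℂ) := by
    rw [mulCfg_eq_mul, hik, hΛ, uTower_lam_eq_u8, hU₁]
  have hlt := ineq145_fails_lineage (0 : Fin 4) h0 h4 hθ y hy
  have hle' : ‖(avgIter 3 (mulCfg (mgauge U₀.1 (uTower 3 one_le_three i.k (i.Λs i.k) U₀.1 P.2.1) P.2.1) U₀.1) 1 y 0 : ℂ)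
      - (avgIter 3 U₀.1 1 y 0 : ℂ)‖ ≤ 2 * α₂ := hle
  rw [hLHS] at hle'
  exact lt_irrefl _ (hle'.trans_lt hlt)

/-- The same on the `zdGF3P₂` face (Proposition 7 reads no source; the fields it reads are `rfl`-equal). [cite: Balaban1985RegularSpaces, Prop. 7 (1.144)–(1.145) p.100] -/
theorem not_prop7PrintedR_zdGF3P₂_toAxialTower_halfspace (β : ℝ) (len : Site 4 → ℝ) :
    ∃ i : ZdIdx 4 3, IdxB8LawsB 3 i ∧ DomainSeq 3 i.Ω ∧ i.Ω 0 = Set.univ ∧ i.Ω = OmegaHS (0 : Fin 4) ∧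
      ¬ B8SectGH.Prop7PrintedR (fun _ : Unit => zdGF3P₂ ℂ 3 β len i) (fun _ => toAxialTower ℂ 3 β len one_le_three i) :=
  not_prop7PrintedR_zdGF3HP₂_toAxialTower_halfspace β len

end Printed

end Literature.MathematicalPhysics.QuantumFieldTheory.Balaban1983to89.B8Prop7PrintedRZdGF3P2HalfSpace

end
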